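import Literature.Analysis.FluidPDE.TypeIAncientMildClassical
import Literature.Analysis.FluidPDE.ChaeAsymptoticallySelfSimilarProfile
import Literature.Analysis.FluidPDE.TsaiSelfSimilarBounded
import HarnessLib

/-!
# Crux `RecurrentLiouville` (stmt-NavierStokesRegularity-1589), line `Sketch` — stub
# `stub_rlSelfSimilarMildVanishes`: a scale-invariant Type-I ancient mild field vanishes

Theorems-only file (no definitions, no named facts).  THE RUNG of the small-hull branch: a
backward **self-similar** Type-I ancient mild solution of Navier–Stokes in the
Koch–Nadirashvili–Seregin–Šverák (Oseen) gauge is identically zero — Leray 1934 / Tsai 1998,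
Theorem 1 at `q = ∞`, with NO spatial decay and NO local-energy hypothesis.

Let `v ∈ IsTypeIAncientMild C` (jointly smooth on `t < 0`, divergence free, Oseen-mild between all
pairs of negative times, `‖v(t, x)‖ ≤ C/√(−t)`) satisfy `c v(c² t, c x) = v(t, x)` for all `c > 0`,
`t < 0`, `x`.  Then `v(t, x) = 0` for all `t < 0`, `x` (`stub_rlSelfSimilarMildVanishes`).

Proof.  `IsTypeIAncientMild.exists_isClassicalNSSolutionOn_Ioo` gives a smooth pressure `π` with
`(v, π)` classical on `(−2, 0)`; scale invariance with `c = √(−t)` says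
`v t = lerayBackward (1/2) 0 U t` for `t < 0`, `U = v(−1)` smooth
(`rlMildVanishes_eq_lerayBackward`), so — rebuilding the classical record for Leray's field field by
field as in `profile_ae_eq_zero_of_classical_representative` — `(U, π(−1))` is a Leray profile with
`ν = 1`, `a = 1/2` (`isLerayProfile_of_isClassical_lerayBackward`); `‖U‖ ≤ C` by the rate at
`t = −1`, so `U` is constant (Tsai 1998, Thm 1, `q = ∞`:
`IsLerayProfile.exists_eq_const_of_bounded`), every slice of `v` is spatially constant, and the
gauge kills it (`IsTypeIAncientMild.eq_zero_of_slice_const`, KNSS 2009, Remark 6.1).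

## References

* J. Leray, Acta Math. 63 (1934), §20, (3.11)–(3.12). [Leray1934]
* T.-P. Tsai, Arch. Rational Mech. Anal. 143 (1998) 29–51, Theorem 1 (p. 31). [Tsai1998]
* G. Koch, N. Nadirashvili, G. Seregin, V. Šverák, Acta Math. 203 (2009) 83–105 =
  arXiv:0709.3599, Remark 6.1. [KochNadirashviliSereginSverak2009]
-/

noncomputable section

-- the sub-problem namespace repeats the summit name (D-0017 layout `Summit.<S>.<P>.Theorems`)
set_option linter.dupNamespace false

namespace Summit.NavierStokesRegularity.NavierStokesRegularity.Theorems

open MeasureTheory Set Function Filter Topology TopologicalSpace Metric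
open Literature.Analysis.FluidPDE
open scoped NNReal ENNReal

/-! ### Scale invariance on the open slab is Leray's backward ansatz -/

/-- A field on `t < 0` with `c v(c² t, c x) = v(t, x)` for all `c > 0`, `t < 0`, `x` is Leray's
backward ansatz (`T = 0`, rate `a = 1/2`) of its slice at `t = −1`:
`v t = lerayBackward (1/2) 0 (v (−1)) t`, i.e. `v(t, x) = (−t)^{-1/2} v(−1, (−t)^{-1/2} x)`
(take `c = √(−t)` at time `−1` and the point `(−t)^{-1/2} x`; Leray 1934, (3.11)).
[cite: Leray1934, §20 (3.11)–(3.12)] -/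
private theorem rlMildVanishes_eq_lerayBackward
    {v : ℝ → EuclideanSpace ℝ (Fin 3) → EuclideanSpace ℝ (Fin 3)}
    (hss : ∀ c : ℝ, 0 < c → ∀ t : ℝ, t < 0 → ∀ x, c • v (c ^ 2 * t) (c • x) = v t x)
    {t : ℝ} (ht : t < 0) : v t = lerayBackward (1 / 2) 0 (v (-1)) t := by
  funext x
  have hnt : 0 < -t := neg_pos.2 ht
  have hs0 : 0 < Real.sqrt (-t) := Real.sqrt_pos.2 hnt
  have hs2 : Real.sqrt (-t) ^ 2 = -t := Real.sq_sqrt hnt.le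
  have e1 : Real.sqrt (2 * (1 / 2) * (0 - t)) = Real.sqrt (-t) := by norm_num
  have key := hss (Real.sqrt (-t)) hs0 (-1) (by norm_num) ((Real.sqrt (-t))⁻¹ • x)
  rw [smul_smul, mul_inv_cancel₀ hs0.ne', one_smul, hs2, mul_neg_one, neg_neg] at key
  rw [lerayBackward_apply, e1, ← key, smul_smul, inv_mul_cancel₀ hs0.ne', one_smul]

/-! ### The stub -/

/-- **THE RUNG: a scale-invariant Type-I ancient mild field vanishes** (Leray 1934 / Tsai 1998
Thm 1 at `q = ∞`, in the KNSS gauge; no spatial decay, no local energy hypothesis).  If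
`v ∈ IsTypeIAncientMild C` satisfies `c v(c²t, cx) = v(t, x)` for all `c > 0`, `t < 0`, `x`, then
`v(t, x) = 0` for all `t < 0`, `x`: `(v, π)` is classical on `(−2, 0)` for a smooth pressure `π`
(`IsTypeIAncientMild.exists_isClassicalNSSolutionOn_Ioo`), `v = lerayBackward (1/2) 0 U`,
`U = v(−1)` smooth, so `(U, π(−1))` is a Leray profile (`isLerayProfile_of_isClassical_lerayBackward`)
bounded by `C`, hence constant (Tsai 1998, Thm 1, `q = ∞`,
`IsLerayProfile.exists_eq_const_of_bounded`); the slices of `v` are then spatially constant and the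
Oseen gauge forces `v = 0` (`IsTypeIAncientMild.eq_zero_of_slice_const`, KNSS 2009, Remark 6.1).
[cite: Tsai1998, Thm 1 (p. 31)]
[cite: KochNadirashviliSereginSverak2009, Remark 6.1] -/
theorem stub_rlSelfSimilarMildVanishes :
    ∀ (C : ℝ) (v : ℝ → EuclideanSpace ℝ (Fin 3) → EuclideanSpace ℝ (Fin 3)),
      IsTypeIAncientMild C v →
      (∀ c : ℝ, 0 < c → ∀ t : ℝ, t < 0 → ∀ x, c • v (c ^ 2 * t) (c • x) = v t x) →
      ∀ t : ℝ, t < 0 → ∀ x, v t x = 0 := by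
  intro C v hv hss t ht x
  -- a smooth pressure making `(v, π)` classical on the window `(-2, 0)`
  obtain ⟨π, hcl⟩ := hv.exists_isClassicalNSSolutionOn_Ioo (t₀ := -2) (by norm_num)
  -- `v` IS Leray's backward field of its smooth slice `U = v (-1)`
  have hwt : ∀ s ∈ Ioo (-2 : ℝ) 0, v s = lerayBackward (1 / 2) 0 (v (-1)) s :=
    fun s hs => rlMildVanishes_eq_lerayBackward hss hs.2
  have hcl' : IsClassicalNSSolutionOn (Ioo (-2 : ℝ) 0) 1 0 (lerayBackward (1 / 2) 0 (v (-1))) π :=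
    { smooth_velocity := hcl.smooth_velocity.congr fun q hq => by
        change lerayBackward (1 / 2) 0 (v (-1)) q.1 q.2 = v q.1 q.2
        rw [hwt q.1 (mem_prod.1 hq).1]
      smooth_pressure := hcl.smooth_pressure
      momentum := fun s hs y => by
        have h1 : timeDerivWithin (Ioo (-2 : ℝ) 0) (lerayBackward (1 / 2) 0 (v (-1))) s y =
            timeDerivWithin (Ioo (-2 : ℝ) 0) v s y := by
          simp only [timeDerivWithin]
          exact derivWithin_congr (fun r hr => by rw [hwt r hr]) (by rw [hwt s hs])
        rw [h1, ← hwt s hs]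
        exact hcl.momentum s hs y
      divFree := fun s hs => by
        rw [← hwt s hs]
        exact hcl.divFree s hs }
  -- Leray's reduction at the normalised time `0 - (2 * (1/2))⁻¹ = -1`
  have hint : (0 : ℝ) - (2 * (1 / 2))⁻¹ ∈ interior (Ioo (-2 : ℝ) 0) := by
    rw [interior_Ioo, mem_Ioo]
    norm_num
  have hprof : IsLerayProfile 1 (1 / 2) (v (-1)) (π (0 - (2 * (1 / 2))⁻¹)) :=
    isLerayProfile_of_isClassical_lerayBackward (by norm_num : (0 : ℝ) < 1 / 2)
      (hv.contDiff_slice (by norm_num)) hint hcl'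
  -- the profile is bounded by the Type I constant, hence constant (Tsai 1998, Thm 1, `q = ∞`)
  have hUb : ∀ y, ‖v (-1) y‖ ≤ C := fun y => by
    have h := hv.norm_le (t := -1) (by norm_num) y
    rwa [neg_neg, Real.sqrt_one, div_one] at h
  obtain ⟨c₀, hc₀⟩ := hprof.exists_eq_const_of_bounded one_pos (by norm_num) ⟨C, hUb⟩
  -- every slice is spatially constant, and the gauge kills slice-constant fields
  have hub : ∀ s : ℝ, s < 0 → ∀ y, v s y = (Real.sqrt (-s))⁻¹ • c₀ := by
    intro s hs y
    have e1 : Real.sqrt (2 * (1 / 2) * (0 - s)) = Real.sqrt (-s) := by norm_num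
    rw [rlMildVanishes_eq_lerayBackward hss hs, lerayBackward_apply, hc₀, e1]
  exact hv.eq_zero_of_slice_const (b := fun s => (Real.sqrt (-s))⁻¹ • c₀) hub ht x

end Summit.NavierStokesRegularity.NavierStokesRegularity.Theorems
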